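import Summits.QuantumFields.BalabanUV.Beta.GAN24.AveragedPropagatorDecayCubic
import Summits.QuantumFields.BalabanUV.Beta.GAN24.AveragedPropagatorInverseOneStep

/-!
# G-an2-4 ∕ (CONV-C), road P2, route R2-S1, VECTOR LAYER, PART 11 — THE INVERSE `(Q_k𝒢_kQ_k*)⁻¹` (the `H_k` denominator; `= Δ_K + a`) IN THE
# KERNEL CURRENCY AT `U = 1`, `a = 1` ON EVERY CUBIC UNIT TORUS — UNCONDITIONAL:
# `‖((c_{RN})⁻¹ − (c_N)⁻¹)(i, i′)‖ ≤ K(d)·((R−1)∕(RN))·(2 + log(RN) + log N)·e^{−δ(d)|i₁ − i′₁|_{T,∞}}` and `‖(c_n)⁻¹(i, i′)‖ ≤ K·e^{−δ|…|}`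

Unit `b2b-balaban-gan24-p2` (gen 30), BINDER row G-an2-4 ∕ (CONV-C), road P2; crux team (2).  Second resolvent identity (Part 7's `covOp_inv_succ_sub`)
+ Part 9's decay law of `c_{RN} − c_N` (`fieldDecay_covOp_succ_sub`, letters = the swarm's `vectorRowDecay_one_cubic`) + the swarm's (V-SINV) in
`RowDecay` form (`AveragedPropagatorInverseUniform.covOp_inv_rowDecay_one`, leaf-03 gen 50; its kernel form gives the bound clause):
 * **`norm_covOp_inv_succ_sub_apply_le_cubic`** — the one-step difference kernel of `(c_n)⁻¹` decays with the rate factor and the log in front;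
 * **`covOp_inv_kernel_decay_cubic`** — the bound clause (leaf-03's `exists_covOp_inv_kernel` re-read on cubic tori at `a = 1`);
 * **`norm_DeltaK_succ_sub_apply_le_cubic`** — the same one-step law for NE2's effective operator `Δ_K = covB⁻¹ − a•1` (`DeltaK_succ_sub_eq`).
READING.  With Parts 6∕7∕10 this completes, for BOTH unit-lattice vector constituents `Q_k𝒢_kQ_k*` and `(Q_k𝒢_kQ_k*)⁻¹` of Bałaban's scheme at
`U = 1`, `a = 1` on cubic tori, BOTH clauses of the row's (CONV-C) SHAPE (k-uniform kernel decay ∧ one-step rate `((R−1)∕(RN))·log` with kernel decay)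
in sup AND kernel currency — position-space, no letter for the non-local `P`.
HONEST SCOPE.  Junction; `U = 1`, `a = 1`, CUBIC; constants existential in `d`; the identification `Δ_K = Δ_k` (1.65) is NOT claimed; NOT (CONV-C) as typed
(fine objects `H_k`, `G(1)`, general `U`), NEVER «G-an2-4 closed», NOT NE2, NOT D1, NOT BetaPertH, NOT continuum, NOT Clay; not in print — our proof.
HONEST DEPENDENCY: continuum YM on T⁴ ⇐ BetaPertH ∧ nine spine estimates (0/9 proved); BetaPertH ⇐ (D1) ∧ (D4) ∧ CAP+tail; G-an2-4 gates asym,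
D1 and NE2/3/4.
-/

noncomputable section

open scoped BigOperators ComplexConjugate Matrix

namespace Summit.QuantumFields.BalabanUV.Beta.GAN24.AveragedPropagatorInverseDecayCubic

open Literature.MathematicalPhysics.QuantumFieldTheory.Balaban1983to89
open B5Prop11Plancherel (Tor fine fdiff)
open B5Blocks16 (blockOf)
open B5DeltaA169 (DeltaA)
open B6LowerBound2153Torus (rep)
open B4TorusKernel.MultiPeriod (torusSupNorm)
open B4Sect5Proof (latticeConst latticeConst_nonneg)
open Summit.QuantumFields.BalabanUV.T4Continuum.BalabanHardMinimizer (DeltaK)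
open Summit.QuantumFields.BalabanUV.Beta.GAN24.StaircaseAveragingDefect (ratio_nonneg)
open Summit.QuantumFields.BalabanUV.Beta.GAN24.AveragedPropagatorTwoLevel (covOp)
open Summit.QuantumFields.BalabanUV.Beta.GAN24.BlockFieldDecay (RowDecay FieldDecay fieldDecay_mulVec)
open Summit.QuantumFields.BalabanUV.Beta.GAN24.AveragedPropagatorOneStepDecay (epsVec fieldDecay_covOp_succ_sub)
open Summit.QuantumFields.BalabanUV.Beta.GAN24.AveragedPropagatorDecayCubic (epsA0 epsA3 epsA4 epsA_nonneg epsVec_le_log)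
open Summit.QuantumFields.BalabanUV.Beta.GAN24.AveragedPropagatorInverseOneStep (covOp_inv_succ_sub DeltaK_succ_sub_eq)
open Summit.QuantumFields.BalabanUV.Beta.GAN24.AveragedPropagatorInverseUniform (covOp_inv_rowDecay_one exists_covOp_inv_kernel)
open Summit.QuantumFields.BalabanUV.Beta.GAN24.VectorRowDecayLetters (vectorRowDecay_one_cubic)

variable (d : ℕ)

/-- **THE ONE-STEP DIFFERENCE KERNEL OF `(Q_k𝒢_kQ_k*)⁻¹` DECAYS, AT `U = 1`, `a = 1`, ON EVERY CUBIC UNIT TORUS — UNCONDITIONAL**: `∃ K δ₄ > 0`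
(functions of `d`) such that for all `N, R, N₀ ≥ 1` and all unit bonds `i, i′`:
`‖((c_{RN})⁻¹ − (c_N)⁻¹)(i, i′)‖ ≤ K·((R−1)∕(RN))·(2 + log(RN) + log N)·e^{−δ₄·|rep i₁ − rep i′₁|_{T,∞}}`. [folklore] -/
theorem norm_covOp_inv_succ_sub_apply_le_cubic :
    ∃ K δ₄ : ℝ, 0 < K ∧ 0 < δ₄ ∧ ∀ (N R N₀ : ℕ) [NeZero N] [NeZero R] [NeZero N₀]
      (i i' : Tor (fun _ : Fin (d + 1) => N₀) × Fin (d + 1)),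
        ‖((covOp (R * N) (fun _ : Fin (d + 1) => N₀) 1)⁻¹ - (covOp N (fun _ : Fin (d + 1) => N₀) 1)⁻¹) i i'‖
          ≤ K * (((R : ℝ) - 1) / ((R : ℝ) * N)) * (2 + Real.log ((R * N : ℕ) : ℝ) + Real.log (N : ℝ))
              * Real.exp (-(δ₄ * torusSupNorm (fun _ : Fin (d + 1) => N₀)
                  (rep (fun _ : Fin (d + 1) => N₀) i.1 - rep (fun _ : Fin (d + 1) => N₀) i'.1))) := by
  obtain ⟨C, δL, hC, hδL, hL⟩ := vectorRowDecay_one_cubic d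
  obtain ⟨σ, δS, hσ, hδS, hS⟩ := covOp_inv_rowDecay_one (d := d)
  -- the common working rate
  set δ : ℝ := min δL (δS / 2) with hδdef
  have hδ : 0 < δ := lt_min hδL (half_pos hδS)
  have hδL' : δ ≤ δL := min_le_left _ _
  have hδS' : δ ≤ δS / 2 := min_le_right _ _
  obtain ⟨hA0, hA3, hA4⟩ := epsA_nonneg d zero_le_one hC.le hC.le hC.le hC.le hδ
  have hK2 := latticeConst_nonneg (d + 1) (half_pos hδS).le
  have hK8 := latticeConst_nonneg (d + 1) (half_pos (show 0 < δ / 4 by positivity)).le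
  set Ktot : ℝ := σ * ((epsA0 d 1 C C δ + (epsA3 d C δ + epsA4 d C δ) * C) * (σ * 1 * latticeConst (d + 1) (δS / 2)))
      * latticeConst (d + 1) (δ / 4 / 2) with hKtot
  refine ⟨Ktot + 1, δ / 4 / 2, by positivity, by positivity, ?_⟩
  intro N R N₀ _ _ _ i i'
  have hN : 1 ≤ N := Nat.one_le_iff_ne_zero.mpr (NeZero.ne N)
  have hRN : 1 ≤ R * N := Nat.one_le_iff_ne_zero.mpr (NeZero.ne (R * N))
  have hlN : 0 ≤ Real.log (N : ℝ) := Real.log_nonneg (by exact_mod_cast hN)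
  have hlRN : 0 ≤ Real.log ((R * N : ℕ) : ℝ) := Real.log_nonneg (by exact_mod_cast hRN)
  have hρ := ratio_nonneg N R
  have hℓ : 0 ≤ 2 + Real.log ((R * N : ℕ) : ℝ) + Real.log (N : ℝ) := by linarith
  -- (1) the source `δ_{i′}` and the coarse leg `c_N⁻¹ δ_{i′}`
  have hsrc : FieldDecay (fun _ : Fin (d + 1) => N₀) Prod.fst (Pi.single i' (1 : ℂ)) 1 δS i'.1 := by
    intro z
    by_cases hz : z = i'
    · rw [hz, Pi.single_eq_same, norm_one, sub_self, T4EtaRateOperatorTorus.torusSupNorm_zero, mul_zero, neg_zero, Real.exp_zero, mul_one]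
    · rw [Pi.single_eq_of_ne hz, norm_zero]; positivity
  have hleg := fieldDecay_mulVec (hS N (fun _ : Fin (d + 1) => N₀) hN) hδS hsrc zero_le_one
  -- (2) the one-step difference at the working rate `δ ≤ δS/2`
  have hN' := fun μ ν => hL N N₀ μ ν
  have hRN' := fun μ ν => hL (R * N) N₀ μ ν
  have hδ2 : δ / 2 ≤ δL := by linarith
  have hmid := fieldDecay_covOp_succ_sub N R (fun _ : Fin (d + 1) => N₀) one_pos hδ (by positivity)
    (C₀ := C) (C₀' := C) (C₁' := C) (C₂ := C) (C₃' := C * (1 + Real.log ((R * N : ℕ) : ℝ))) (C₄ := C * (1 + Real.log (N : ℝ)))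
    ((hN' 0 0).1.mono le_rfl hC.le hδL') (fun ν => (hN' 0 ν).2.2.1.mono le_rfl hC.le hδL')
    (fun μ ν => (hN' μ ν).2.2.2.2.mono le_rfl (by positivity) hδL')
    ((hRN' 0 0).1.mono le_rfl hC.le hδ2) (fun ν => (hRN' 0 ν).2.1.mono le_rfl hC.le hδ2)
    (fun μ ν => (hRN' μ ν).2.2.2.1.mono le_rfl (by positivity) hδ2)
    (hleg.mono le_rfl (by positivity) hδS')
  -- (3) the fine-level leg `c_{RN}⁻¹`
  have hδ4S : δ / 4 ≤ δS := by linarith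
  have h3' : 0 ≤ C * (1 + Real.log ((R * N : ℕ) : ℝ)) := mul_nonneg hC.le (by linarith)
  have h4' : 0 ≤ C * (1 + Real.log (N : ℝ)) := mul_nonneg hC.le (by linarith)
  have hEps : 0 ≤ epsVec d 1 C C C C (C * (1 + Real.log ((R * N : ℕ) : ℝ))) (C * (1 + Real.log (N : ℝ))) δ := by
    rw [AveragedPropagatorDecayCubic.epsVec_eq]
    exact add_nonneg (add_nonneg hA0 (mul_nonneg hA3 h3')) (mul_nonneg hA4 h4')
  have hout := fieldDecay_mulVec ((hS (R * N) (fun _ : Fin (d + 1) => N₀) hRN).mono le_rfl hσ.le hδ4S) (by positivity : 0 < δ / 4) hmid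
    (mul_nonneg (mul_nonneg hρ hEps) (by positivity))
  -- (4) the identity and the kernel reading
  have e : ((covOp (R * N) (fun _ : Fin (d + 1) => N₀) 1)⁻¹ - (covOp N (fun _ : Fin (d + 1) => N₀) 1)⁻¹) i i'
      = -(((covOp (R * N) (fun _ : Fin (d + 1) => N₀) 1)⁻¹ *ᵥ ((covOp (R * N) (fun _ : Fin (d + 1) => N₀) 1 - covOp N (fun _ : Fin (d + 1) => N₀) 1) *ᵥ ((covOp N (fun _ : Fin (d + 1) => N₀) 1)⁻¹ *ᵥ Pi.single i' (1 : ℂ)))) i) := by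
    rw [covOp_inv_succ_sub N R (fun _ : Fin (d + 1) => N₀) one_pos, Matrix.mulVec_mulVec, Matrix.mulVec_mulVec, Matrix.mulVec_single_one, Matrix.neg_apply]
    rfl
  rw [e, norm_neg]
  refine (hout i).trans ?_
  have hE := Real.exp_pos (-(δ / 4 / 2 * torusSupNorm (fun _ : Fin (d + 1) => N₀) (rep (fun _ : Fin (d + 1) => N₀) i.1 - rep (fun _ : Fin (d + 1) => N₀) i'.1)))
  have hbound := epsVec_le_log d zero_le_one hC.le hC.le hC.le hC.le hC.le hδ hlRN hlN (a := 1) (C₀ := C) (C₀' := C)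
  -- `σ·(ρ·epsVec·(σ·1·K₂))·K₈ ≤ (Ktot + 1)·ρ·ℓ`
  have h1 : σ * ((((R : ℝ) - 1) / ((R : ℝ) * N)) * epsVec d 1 C C C C (C * (1 + Real.log ((R * N : ℕ) : ℝ))) (C * (1 + Real.log (N : ℝ))) δ
        * (σ * 1 * latticeConst (d + 1) (δS / 2))) * latticeConst (d + 1) (δ / 4 / 2)
      ≤ Ktot * (((R : ℝ) - 1) / ((R : ℝ) * N)) * (2 + Real.log ((R * N : ℕ) : ℝ) + Real.log (N : ℝ)) := by
    rw [hKtot]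
    have h2 : 0 ≤ σ * (σ * 1 * latticeConst (d + 1) (δS / 2)) * latticeConst (d + 1) (δ / 4 / 2) := by positivity
    calc _ = (σ * (σ * 1 * latticeConst (d + 1) (δS / 2)) * latticeConst (d + 1) (δ / 4 / 2)) * ((((R : ℝ) - 1) / ((R : ℝ) * N))
              * epsVec d 1 C C C C (C * (1 + Real.log ((R * N : ℕ) : ℝ))) (C * (1 + Real.log (N : ℝ))) δ) := by ring
      _ ≤ (σ * (σ * 1 * latticeConst (d + 1) (δS / 2)) * latticeConst (d + 1) (δ / 4 / 2)) * ((((R : ℝ) - 1) / ((R : ℝ) * N))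
              * ((epsA0 d 1 C C δ + (epsA3 d C δ + epsA4 d C δ) * C) * (2 + Real.log ((R * N : ℕ) : ℝ) + Real.log (N : ℝ)))) :=
          mul_le_mul_of_nonneg_left (mul_le_mul_of_nonneg_left hbound hρ) h2
      _ = _ := by ring
  have h3 : Ktot * (((R : ℝ) - 1) / ((R : ℝ) * N)) * (2 + Real.log ((R * N : ℕ) : ℝ) + Real.log (N : ℝ))
      ≤ (Ktot + 1) * (((R : ℝ) - 1) / ((R : ℝ) * N)) * (2 + Real.log ((R * N : ℕ) : ℝ) + Real.log (N : ℝ)) := by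
    have := mul_nonneg hρ hℓ
    nlinarith
  exact (mul_le_mul_of_nonneg_right (h1.trans h3) hE.le)

/-- **THE BOUND CLAUSE FOR THE INVERSE** (leaf-03's kernel form of (V-SINV), every torus, here read at `a = 1` on cubic tori): `∃ K δ₄ > 0`,
`‖(covOp n (fun _ : Fin (d + 1) => N₀) 1)⁻¹ i i′‖ ≤ K·e^{−δ₄|rep i₁ − rep i′₁|_{T,∞}}` for every `n, N₀ ≥ 1`. [folklore] -/
theorem covOp_inv_kernel_decay_cubic :
    ∃ K δ₄ : ℝ, 0 < K ∧ 0 < δ₄ ∧ ∀ (n N₀ : ℕ) [NeZero n] [NeZero N₀] (i i' : Tor (fun _ : Fin (d + 1) => N₀) × Fin (d + 1)),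
      ‖(covOp n (fun _ : Fin (d + 1) => N₀) 1)⁻¹ i i'‖
        ≤ K * Real.exp (-(δ₄ * torusSupNorm (fun _ : Fin (d + 1) => N₀)
            (rep (fun _ : Fin (d + 1) => N₀) i.1 - rep (fun _ : Fin (d + 1) => N₀) i'.1))) := by
  obtain ⟨c₀, δ₀, hc, hδ, h⟩ := exists_covOp_inv_kernel (d := d)
  exact ⟨1 + c₀, δ₀, by positivity, hδ, fun n N₀ _ _ i i' => h n (fun _ : Fin (d + 1) => N₀) 1 one_pos i i'⟩

/-- **THE ONE-STEP DIFFERENCE KERNEL OF NE2's EFFECTIVE OPERATOR `Δ_K`** (`= covB⁻¹ − a•1`; `DeltaK_succ_sub_eq`) at `a = 1` on cubic tori,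
UNCONDITIONAL. [folklore] -/
theorem norm_DeltaK_succ_sub_apply_le_cubic :
    ∃ K δ₄ : ℝ, 0 < K ∧ 0 < δ₄ ∧ ∀ (N R N₀ : ℕ) [NeZero N] [NeZero R] [NeZero N₀] (hN : 1 ≤ N) (hRN : 1 ≤ R * N)
      (i i' : Tor (fun _ : Fin (d + 1) => N₀) × Fin (d + 1)),
        ‖(DeltaK (R * N) hRN (fun _ : Fin (d + 1) => N₀) 1 one_pos - DeltaK N hN (fun _ : Fin (d + 1) => N₀) 1 one_pos) i i'‖
          ≤ K * (((R : ℝ) - 1) / ((R : ℝ) * N)) * (2 + Real.log ((R * N : ℕ) : ℝ) + Real.log (N : ℝ))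
              * Real.exp (-(δ₄ * torusSupNorm (fun _ : Fin (d + 1) => N₀)
                  (rep (fun _ : Fin (d + 1) => N₀) i.1 - rep (fun _ : Fin (d + 1) => N₀) i'.1))) := by
  obtain ⟨K, δ₄, hK, hδ₄, h⟩ := norm_covOp_inv_succ_sub_apply_le_cubic d
  refine ⟨K, δ₄, hK, hδ₄, fun N R N₀ _ _ _ hN hRN i i' => ?_⟩
  rw [DeltaK_succ_sub_eq N R (fun _ : Fin (d + 1) => N₀) one_pos hN hRN]
  exact h N R N₀ i i'

end Summit.QuantumFields.BalabanUV.Beta.GAN24.AveragedPropagatorInverseDecayCubic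

end
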